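import Literature.IUT.LogThetaLattice.VerticallyCoricLGPBad
import HarnessLib

/-!
# [IUTchIII] Proposition 3.5 (ii) (c) "(Bad Primes)" at the level of the TENSOR PACKETS of Proposition 3.2
# (ii) — `𝓘^ℚ(^{S^±_{j+1},j}𝓕(^{n,∘}𝔇_≻)_v) ⊆ log(^{S^±_{j+1},j}𝓕(^{n,∘}𝔇_≻)_v)` — proof-only companion of
# `VerticallyCoricLGP.lean` / `TensorPackets.lean` (abc-iut cell, layer L6, slice [IUTchIII] §3; node
# IUTchIII:Prop3.5(ii); packet-level sequel of `VerticallyCoricLGPBad.lean`)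

S. Mochizuki, *Inter-universal Teichmüller theory III*, kurims manuscript (May 2020), §3, Proposition 3.5
(ii) (c), pp. 105–106 [claim: Mochizuki2012, status: disputed]: the splitting monoids
`Ψ^⊥_{𝓕_LGP}(^{n,m}𝓗𝓣^{Θ±ell NF})_v`, `m ∈ ℤ`, act "via the [relevant] Kummer isomorphisms of (i)" on "the
ind-topological modules `𝓘^ℚ(^{S^±_{j+1},j}𝓕(^{n,∘}𝔇_≻)_v) ⊆ log(^{S^±_{j+1},j}𝓕(^{n,∘}𝔇_≻)_v)` [where
`j = 1, …, l^⋇`] — i.e., that arise from applying the constructions of Proposition 3.4, (ii), in the vertically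
coric context of (i) above [cf. also the notational conventions of Proposition 3.2, (ii)]", mutually
compatibly "in the sense that the only portions of these actions that are possibly related to one another
via these log-links are the indeterminacies with respect to multiplication by roots of unity in the domains
of the log-links". Proposition 3.2 (ii), p. 99: "`𝓘^ℚ((−))` … the `ℚ`-span of `𝓘((−))`"; p. 98:
`𝓘(^{A,α}𝒟^⊢_v) ⊆ log(^{A,α}𝒟^⊢_v)` "by forming suitable … tensor products".

`VerticallyCoricLGPBad.lean` (this seat) discharges clause (c) at ONE FACTOR (the coric field `K_v`). This
file lifts it to the printed carrier, abc-iut-L6-t4's `(A, α)`-PACKET `log(^{A,α}𝓕_v) = log(^α𝓕_v) ⊗ (⊗_{β≠α}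
⊕_w log(^β𝓕_w))` (`PacketAt` / `MPacketAt`, `TensorPackets.lean` p403825, with `A = S^±_{j+1}`, `α = j`) and
its packet log-shell `𝓘(^{A,α}𝒟^⊢_v)` (`shellPacketAt`, generated by the tensors `x ⊗ (⊗_β y_β)` of shell
elements) over the genuine `p`-adic data (fields `K α v` = mixed-characteristic ultrametric normed fields with a
`ℚ_p`-algebra structure bounded for the norms — `Algebra ℚ_[p]` + `IsBoundedSMul ℚ_[p]`, e.g. from
`NormedAlgebra ℚ_[p] (K α v)`; models `Lg α v : PadicLogOnUnits (K α v)` of the `p`-adic logarithms on units,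
abc-iut-L4-t3):

* **`shellQSpan_shellPacketAt_eq_top`, `shellQSpan_shellPacketN_eq_top` — `𝓘^ℚ = the whole packet`**: the
  span (abc-iut-L6-t4's `shellQSpan`, the `ℚ_p`-span) of the packet log-shell `𝓘(^{A,α}𝒟^⊢_v)`, resp.
  `𝓘(^A𝒟^⊢_{v_ℚ})` (`shellPacketN`), is ALL of `log(^{A,α}𝒟^⊢_v)`, resp. `log(^A𝒟^⊢_{v_ℚ})` — every pure
  tensor is a `p`-power multiple of a pure tensor of integers (`span_integralPureTensorsAt_eq_top`,
  `span_integralPureTensorsN_eq_top`; multilinearity + `‖p^n x‖ → 0`), and integers lie in the log-shells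
  ([IUTchIII] Rmk. 1.2.2 (i) "`𝒪 ⊆ ℐ`", abc-iut-L4-t3's `closedBall_subset_logShell`);
* **`prop35ii_c_shellPacketAt` — `Prop35ii_c` HOLDS at the packet**: coric ring `log(^{A,α}𝓕(^{n,∘}𝔇_≻)_v)`
  (`PacketAt`), `𝓘^ℚ := 𝓘^ℚ(^{A,α}…)` as a `ℤ`-submodule, splitting monoids `Ψ^⊥ = μ_{2l} · q^{j²ℕ} ⊆ K_{α,v}`
  (abc-iut-L6-t2's `splittingMonoidAt`, `‖q‖ < 1`, `j ≠ 0`) for every `m`, Kummer maps = the ring map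
  `log(^α𝓕_v) → log(^{A,α}𝓕_v)` "tensor with `1`'s" (abc-iut-L6-t4's `toPacketAt`, Prop. 3.1 (ii)) restricted
  to `Ψ^⊥`, "related via the log-links" = both in the domains of the log-links (`iterDomain (Lg α v) 1`):
  the splitting monoids act multiplicatively on `𝓘^ℚ` and log-link-related elements have Kummer images
  differing by a root of unity of the packet ring (the image of `y · x⁻¹ ∈ μ_{2l}(K_{α,v})`);
* `logKummerCorrespondence'_shellPacketAt` — the per-index log-Kummer correspondence (closing paragraph,
  p. 106) HOLDS at the packet for the splitting monoids.

No new definitions; classical `p`-adic / multilinear bookkeeping over landed definitions. Nothing here bears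
on the disputed [IUTchIII] Cor. 3.12 or takes a side; typed ≠ discharged elsewhere; instantiated ≠ endorsed.
-/

noncomputable section

namespace Literature.IUT.LogThetaLattice

open Set Metric Filter
open Literature.AnabelianGeometry.AbsoluteAnabelian Literature.IUT.HodgeArakelov
open scoped TensorProduct
open PiTensorProduct

universe v v' w

section Packets

variable (p : ℕ) [Fact p.Prime]
variable {A : Type v} [Fintype A] {Vfib : Type v'} [Fintype Vfib]
-- The `ℚ_p`-algebra structure and its compatibility with the norms are taken as the two classes
-- `Algebra ℚ_[p]` + `IsBoundedSMul ℚ_[p]` (supplied e.g. by `NormedAlgebra ℚ_[p] (K α v)`), so that the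
-- commutative-ring structure of the packet `PacketAt ℚ_[p] K α v` is found by instance resolution.
variable (K : A → Vfib → Type w) [∀ α v, NontriviallyNormedField (K α v)]
  [∀ α v, Algebra ℚ_[p] (K α v)] [∀ α v, IsBoundedSMul ℚ_[p] (K α v)] [∀ α v, IsUltrametricDist (K α v)]
variable (Lg : ∀ α v, PadicLogOnUnits (K α v))

/-! ### `𝓘^ℚ` of a tensor packet is the whole packet -/

/-- `‖p^n · e‖ ≤ 1` for all large `n`, in any seminormed `ℚ_p`-module with bounded scalar multiplication
(`‖p^n · e‖ ≤ ‖p‖^n ‖e‖`, `‖p‖ = p⁻¹ < 1`). [folklore] -/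
private theorem eventually_norm_pow_smul_le_one {E : Type*} [SeminormedAddCommGroup E]
    [Module ℚ_[p] E] [IsBoundedSMul ℚ_[p] E] (e : E) :
    ∀ᶠ n : ℕ in atTop, ‖((p : ℚ_[p]) ^ n) • e‖ ≤ 1 := by
  have hp1 : ‖(p : ℚ_[p])‖ < 1 := by
    rw [Padic.norm_p]
    exact inv_lt_one_of_one_lt₀ (by exact_mod_cast (Fact.out : p.Prime).one_lt)
  have ht : Tendsto (fun n : ℕ => ‖(p : ℚ_[p])‖ ^ n * ‖e‖) atTop (nhds (0 * ‖e‖)) :=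
    (tendsto_pow_atTop_nhds_zero_of_lt_one (norm_nonneg _) hp1).mul_const _
  rw [zero_mul] at ht
  filter_upwards [ht.eventually_lt_const zero_lt_one] with n hn
  calc ‖((p : ℚ_[p]) ^ n) • e‖ ≤ ‖(p : ℚ_[p]) ^ n‖ * ‖e‖ := norm_smul_le _ _
    _ = ‖(p : ℚ_[p])‖ ^ n * ‖e‖ := by rw [norm_pow]
    _ ≤ 1 := hn.le

omit [∀ α v, IsUltrametricDist (K α v)] in
/-- In the `(A, α)`-packet `log(^{A,α}𝒟^⊢_v) = log(^α𝒟^⊢_v) ⊗ (⊗_{β≠α} ⊕_w log(^β𝒟^⊢_w))` ([IUTchIII] Prop. 3.2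
p. 98, abc-iut-L6-t4's `MPacketAt` over `ℚ_p`), the tensors `x ⊗ (⊗_β y_β)` of INTEGERS (`‖x‖ ≤ 1`,
`‖y_{β,w}‖ ≤ 1`) span the whole packet over `ℚ_p`: any pure tensor is `p^{-n(1+|A∖{α}|)}` times such a tensor
for `n` large (multilinearity), and pure tensors span. PROVED. [claim: Mochizuki2012, status: disputed] -/
theorem span_integralPureTensorsAt_eq_top (α : A) (v : Vfib) :
    Submodule.span ℚ_[p]
      {t : MPacketAt ℚ_[p] K α v | ∃ (x : K α v) (y : ∀ β : {β : A // β ≠ α}, MPacket1 K β.1),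
        ‖x‖ ≤ 1 ∧ (∀ β w, ‖y β w‖ ≤ 1) ∧ t = x ⊗ₜ[ℚ_[p]] tprod ℚ_[p] y} = ⊤ := by
  classical
  set W := Submodule.span ℚ_[p]
      {t : MPacketAt ℚ_[p] K α v | ∃ (x : K α v) (y : ∀ β : {β : A // β ≠ α}, MPacket1 K β.1),
        ‖x‖ ≤ 1 ∧ (∀ β w, ‖y β w‖ ≤ 1) ∧ t = x ⊗ₜ[ℚ_[p]] tprod ℚ_[p] y} with hW
  have hp0 : (p : ℚ_[p]) ≠ 0 := by exact_mod_cast (Fact.out : p.Prime).ne_zero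
  -- every pure tensor lies in `W`
  have hA : ∀ (x : K α v) (y : ∀ β : {β : A // β ≠ α}, MPacket1 K β.1),
      x ⊗ₜ[ℚ_[p]] tprod ℚ_[p] y ∈ W := by
    intro x y
    obtain ⟨n, hnx, hny⟩ : ∃ n : ℕ, ‖((p : ℚ_[p]) ^ n) • x‖ ≤ 1 ∧
        ∀ β : {β : A // β ≠ α}, ∀ w : Vfib, ‖((p : ℚ_[p]) ^ n) • y β w‖ ≤ 1 := by
      have h1 := eventually_norm_pow_smul_le_one p x
      have h2 : ∀ᶠ n : ℕ in atTop, ∀ βw : {β : A // β ≠ α} × Vfib,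
          ‖((p : ℚ_[p]) ^ n) • y βw.1 βw.2‖ ≤ 1 :=
        eventually_all.mpr fun βw => eventually_norm_pow_smul_le_one p (y βw.1 βw.2)
      obtain ⟨n, hn1, hn2⟩ := (h1.and h2).exists
      exact ⟨n, hn1, fun β w => hn2 (β, w)⟩
    set c : ℚ_[p] := (p : ℚ_[p]) ^ n with hc
    have hc0 : c ≠ 0 := pow_ne_zero n hp0
    have hmem : (c • x) ⊗ₜ[ℚ_[p]] tprod ℚ_[p] (fun β => c • y β) ∈ W :=
      Submodule.subset_span ⟨c • x, fun β => c • y β, hnx, fun β w => hny β w, rfl⟩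
    have hrel : (c • x) ⊗ₜ[ℚ_[p]] tprod ℚ_[p] (fun β => c • y β) =
        (c * ∏ _β : {β : A // β ≠ α}, c) • (x ⊗ₜ[ℚ_[p]] tprod ℚ_[p] y) := by
      rw [MultilinearMap.map_smul_univ, TensorProduct.tmul_smul, TensorProduct.smul_tmul',
        TensorProduct.smul_tmul', smul_smul, mul_comm]
    have hcc : (c * ∏ _β : {β : A // β ≠ α}, c) ≠ 0 :=
      mul_ne_zero hc0 (Finset.prod_ne_zero_iff.mpr fun _ _ => hc0)
    have h := Submodule.smul_mem W ((c * ∏ _β : {β : A // β ≠ α}, c)⁻¹) hmem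
    rwa [hrel, smul_smul, inv_mul_cancel₀ hcc, one_smul] at h
  -- pure tensors span
  rw [eq_top_iff]
  rintro t -
  induction t using TensorProduct.induction_on with
  | zero => exact W.zero_mem
  | tmul x z =>
    induction z using PiTensorProduct.induction_on with
    | smul_tprod r f =>
      rw [TensorProduct.tmul_smul]
      exact W.smul_mem r (hA x f)
    | add z₁ z₂ h₁ h₂ =>
      rw [TensorProduct.tmul_add]
      exact W.add_mem h₁ h₂
  | add t₁ t₂ h₁ h₂ => exact W.add_mem h₁ h₂

/-- **IUTchIII:Prop3.2(ii)** / **IUTchIII:Prop3.5(ii)(c)** (kurims p. 99, p. 105): **`𝓘^ℚ(^{A,α}𝒟^⊢_v) =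
log(^{A,α}𝒟^⊢_v)`** — the span (abc-iut-L6-t4's `shellQSpan` over `ℚ_p`, "the `ℚ`-span of `𝓘`") of the packet
log-shell `𝓘(^{A,α}𝒟^⊢_v)` (`shellPacketAt`, generated by the tensors `x ⊗ (⊗_β y_β)` of elements of the local
log-shells `ℐ_{α,v}`, `ℐ_{β,w}` of the models `Lg`) is the WHOLE `(A, α)`-packet: the local log-shells contain
the integers (abc-iut-L4-t3's `closedBall_subset_logShell`) and the integral pure tensors span
(`span_integralPureTensorsAt_eq_top`). PROVED. [claim: Mochizuki2012, status: disputed] -/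
theorem shellQSpan_shellPacketAt_eq_top (α : A) (v : Vfib) :
    shellQSpan ℚ_[p]
      (shellPacketAt ℚ_[p] K (fun α v => AddSubgroup.closure (logShell (Lg α v))) α v) = ⊤ := by
  refine eq_top_iff.mpr
    ((span_integralPureTensorsAt_eq_top p K α v).symm.le.trans (Submodule.span_le.mpr ?_))
  rintro _ ⟨x, y, hx, hy, rfl⟩
  refine shell_le_shellQSpan ℚ_[p] _ (AddSubgroup.subset_closure ⟨x, y, ?_, fun β => ?_, rfl⟩)
  · exact AddSubgroup.subset_closure
      (closedBall_subset_logShell (Lg α v) (by rwa [mem_closedBall, dist_zero_right]))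
  · exact (AddSubgroup.mem_pi _).mpr fun w _ => AddSubgroup.subset_closure
      (closedBall_subset_logShell (Lg β.1 w) (by rw [mem_closedBall, dist_zero_right]; exact hy β w))

omit [∀ α v, IsUltrametricDist (K α v)] in
/-- In the `n`-tensor packet `log(^A𝒟^⊢_{v_ℚ}) = ⊗_{α∈A} ⊕_{v|v_ℚ} log(^α𝒟^⊢_v)` ([IUTchIII] Prop. 3.2 p. 98,
abc-iut-L6-t4's `MPacketN` over `ℚ_p`), the pure tensors `⊗_α x_α` of INTEGERS (`‖x_{α,v}‖ ≤ 1`) span the whole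
packet over `ℚ_p`. PROVED. [claim: Mochizuki2012, status: disputed] -/
theorem span_integralPureTensorsN_eq_top :
    Submodule.span ℚ_[p]
      {t : MPacketN ℚ_[p] K | ∃ x : ∀ α, MPacket1 K α, (∀ α v, ‖x α v‖ ≤ 1) ∧ t = tprod ℚ_[p] x} = ⊤ := by
  classical
  set W := Submodule.span ℚ_[p]
      {t : MPacketN ℚ_[p] K | ∃ x : ∀ α, MPacket1 K α, (∀ α v, ‖x α v‖ ≤ 1) ∧ t = tprod ℚ_[p] x} with hW
  have hp0 : (p : ℚ_[p]) ≠ 0 := by exact_mod_cast (Fact.out : p.Prime).ne_zero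
  have hA : ∀ x : ∀ α, MPacket1 K α, tprod ℚ_[p] x ∈ W := by
    intro x
    obtain ⟨n, hn⟩ : ∃ n : ℕ, ∀ α v, ‖((p : ℚ_[p]) ^ n) • x α v‖ ≤ 1 := by
      have h : ∀ᶠ n : ℕ in atTop, ∀ αv : A × Vfib, ‖((p : ℚ_[p]) ^ n) • x αv.1 αv.2‖ ≤ 1 :=
        eventually_all.mpr fun αv => eventually_norm_pow_smul_le_one p (x αv.1 αv.2)
      obtain ⟨n, hn⟩ := h.exists
      exact ⟨n, fun α v => hn (α, v)⟩
    set c : ℚ_[p] := (p : ℚ_[p]) ^ n with hc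
    have hc0 : c ≠ 0 := pow_ne_zero n hp0
    have hmem : tprod ℚ_[p] (fun α => c • x α) ∈ W :=
      Submodule.subset_span ⟨fun α => c • x α, fun α v => hn α v, rfl⟩
    have hrel : tprod ℚ_[p] (fun α => c • x α) = (∏ _α : A, c) • tprod ℚ_[p] x := by
      rw [MultilinearMap.map_smul_univ]
    have hcc : (∏ _α : A, c) ≠ 0 := Finset.prod_ne_zero_iff.mpr fun _ _ => hc0
    have h := Submodule.smul_mem W ((∏ _α : A, c)⁻¹) hmem
    rwa [hrel, smul_smul, inv_mul_cancel₀ hcc, one_smul] at h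
  rw [eq_top_iff]
  rintro t -
  induction t using PiTensorProduct.induction_on with
  | smul_tprod r f => exact W.smul_mem r (hA f)
  | add z₁ z₂ h₁ h₂ => exact W.add_mem h₁ h₂

/-- **IUTchIII:Prop3.2(ii)** / **IUTchIII:Prop3.5(ii)(a)** (kurims p. 99, pp. 104–105): **`𝓘^ℚ(^A𝒟^⊢_{v_ℚ}) =
log(^A𝒟^⊢_{v_ℚ})`** — the span of the `n`-packet log-shell `𝓘(^A𝒟^⊢_{v_ℚ})` (abc-iut-L6-t4's `shellPacketN`,
generated by the pure tensors of elements of `⊕_v ℐ_{α,v}`) is the WHOLE `n`-tensor packet. PROVED.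
[claim: Mochizuki2012, status: disputed] -/
theorem shellQSpan_shellPacketN_eq_top :
    shellQSpan ℚ_[p] (shellPacketN ℚ_[p] K (fun α v => AddSubgroup.closure (logShell (Lg α v)))) = ⊤ := by
  refine eq_top_iff.mpr
    ((span_integralPureTensorsN_eq_top p K).symm.le.trans (Submodule.span_le.mpr ?_))
  rintro _ ⟨x, hx, rfl⟩
  refine shell_le_shellQSpan ℚ_[p] _ (AddSubgroup.subset_closure ⟨x, fun α => ?_, rfl⟩)
  exact (AddSubgroup.mem_pi _).mpr fun w _ => AddSubgroup.subset_closure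
    (closedBall_subset_logShell (Lg α w) (by rw [mem_closedBall, dist_zero_right]; exact hx α w))

/-! ### Proposition 3.5 (ii) (c) at the `(S^±_{j+1}, j)`-packet -/

variable {twoL : ℕ} {j : ℕ}

/-- **IUTchIII:Prop3.5(ii)(c)** (kurims pp. 105–106) **"(Bad Primes)" — `Prop35ii_c` HOLDS AT THE PRINTED
CARRIER**, the `(A, α)`-packet `log(^{A,α}𝓕(^{n,∘}𝔇_≻)_v)` (`A = S^±_{j+1}`, `α =` the label `j`; abc-iut-L6-t4's
`PacketAt` over `ℚ_p`, a commutative ring) with `𝓘^ℚ := 𝓘^ℚ(^{A,α}𝓕(^{n,∘}𝔇_≻)_v)` (the span of the packet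
log-shell `shellPacketAt`, as a `ℤ`-submodule): the splitting monoids `Ψ^⊥_{𝓕_LGP}(^{n,m}−)_v := μ_{2l} · q^{j²ℕ}
⊆ K_{α,v}` (abc-iut-L6-t2's `splittingMonoidAt`, `‖q‖ < 1`, `j ≠ 0`, `2l > 0`; the same for every `m`,
vertical coricity) act on `𝓘^ℚ` through the Kummer maps `Ψ^⊥ ↪ K_{α,v} → log(^{A,α}𝓕_v)` (the inclusion
followed by abc-iut-L6-t4's `toPacketAt`, "tensor with `1`'s", Prop. 3.1 (ii)), and two elements both lying
in the domains of the log-links (`iterDomain (Lg α v) 1`) have Kummer images differing by a root of unity of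
the packet ring. PROVED. [claim: Mochizuki2012, status: disputed] -/
theorem prop35ii_c_shellPacketAt (α : A) (v : Vfib) {q : K α v} (hq : ‖q‖ < 1) (hj : j ≠ 0)
    (hl : 0 < twoL) :
    Prop35ii_c (R := PacketAt ℚ_[p] K α v)
      ((shellQSpan ℚ_[p]
        (shellPacketAt ℚ_[p] K (fun α v => AddSubgroup.closure (logShell (Lg α v))) α v)).restrictScalars ℤ)
      (fun _ : ℤ => ↥(splittingMonoidAt (K α v) twoL q j))
      (fun _ => ((toPacketAt ℚ_[p] K α v).toRingHom.toMonoidHom).comp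
        (splittingMonoidAt (K α v) twoL q j).subtype)
      (fun _ x y => (x : K α v) ∈ iterDomain (Lg α v) 1 ∧ (y : K α v) ∈ iterDomain (Lg α v) 1) := by
  refine ⟨fun _ _ a _ => ?_, fun m x y hxy => ?_⟩
  · rw [Submodule.restrictScalars_mem, shellQSpan_shellPacketAt_eq_top p K Lg α v]
    exact Submodule.mem_top
  · obtain ⟨hx, hy⟩ := hxy
    have hxt : (x : K α v) ^ twoL = 1 := (mem_iterDomain_one_iff_pow_eq_one (Lg α v) hq hj hl x.2).mp hx
    have hyt : (y : K α v) ^ twoL = 1 := (mem_iterDomain_one_iff_pow_eq_one (Lg α v) hq hj hl y.2).mp hy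
    have hx0 : (x : K α v) ≠ 0 := by
      intro h0
      rw [h0, zero_pow hl.ne'] at hxt
      exact zero_ne_one hxt
    refine ⟨toPacketAt ℚ_[p] K α v ((y : K α v) * (x : K α v)⁻¹), ⟨twoL, hl, ?_⟩, ?_⟩
    · rw [← map_pow, mul_pow, inv_pow, hxt, hyt, inv_one, mul_one, map_one]
    · show toPacketAt ℚ_[p] K α v (y : K α v) =
        toPacketAt ℚ_[p] K α v ((y : K α v) * (x : K α v)⁻¹) * toPacketAt ℚ_[p] K α v (x : K α v)
      rw [← map_mul, inv_mul_cancel_right₀ hx0]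

/-- **IUTchIII:Prop3.5(ii)** closing paragraph (kurims p. 106) — the per-index **log-Kummer correspondence**
`logKummerCorrespondence'` HOLDS at the `(A, α)`-packet for the splitting monoids: every Frobenius-like copy
`μ_{2l} · q^{j²ℕ}`, `m ∈ ℤ`, acts on the one coric `𝓘^ℚ(^{A,α}𝓕(^{n,∘}𝔇_≻)_v)` through the same Kummer image.
PROVED. [claim: Mochizuki2012, status: disputed] -/
theorem logKummerCorrespondence'_shellPacketAt (α : A) (v : Vfib) (q : K α v) :
    logKummerCorrespondence' (R := PacketAt ℚ_[p] K α v)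
      ((shellQSpan ℚ_[p]
        (shellPacketAt ℚ_[p] K (fun α v => AddSubgroup.closure (logShell (Lg α v))) α v)).restrictScalars ℤ)
      (fun _ : ℤ => ↥(splittingMonoidAt (K α v) twoL q j))
      (fun _ => ((toPacketAt ℚ_[p] K α v).toRingHom.toMonoidHom).comp
        (splittingMonoidAt (K α v) twoL q j).subtype) := by
  refine ⟨fun _ _ a _ => ?_, fun _ => rfl⟩
  rw [Submodule.restrictScalars_mem, shellQSpan_shellPacketAt_eq_top p K Lg α v]
  exact Submodule.mem_top

end Packets

end Literature.IUT.LogThetaLattice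

end
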